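import Mathlib
import Summits.ValiantsHypothesis.ValiantsHypothesis.Theorems.LacunarySymmetroidMatrixDescartesMonotoneFlag
import Summits.ValiantsHypothesis.ValiantsHypothesis.Theorems.LacunarySymmetroidMatrixDescartesInertiaJump

/-!
# `MatrixDescartes` (stmt-ValiantsHypothesis-18050) — FLAG FORM OF THE EXACT MONOTONE COUNT, I: THE ONE-RATE CORE LEMMA
# (an asymptotic positive family for `y•P + S₀ − y⁻¹•N` from the positive eigenvectors of `P` and of the compression `Bᵀ S₀ B`)

HONEST FRAMING.  Cell `pub-symmetroid`, seat `val-sym-mdr-p2` (gen 22); helper file `--supports` the crux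
`Theses.LacunarySymmetroid.MatrixDescartes` (OPEN), NO closure claim.  Pure linear algebra / topology (kit for the companion files
`…MonotoneFlagEnds`, `…MonotoneFlagExact`, which turn THE FLAG BOUND of `…MonotoneFlag` into an equality).  Nothing here bears on the
crux in its window, `stub_twoSided`, `DoorA26` / `DoorA34`, registers, or `VP ≠ VNP`.

* §0 `gramForm_eq` (`cᵀ[v_k ⬝ G v_{k'}]c = (Σ c_k v_k)ᵀ G (Σ c_k v_k)`), `continuous_gramEntry` (entrywise continuity of the Gram matrix
  of a continuous scale-dependent family under a continuous matrix family).
* §1 `mulVec_mulVec_eq_zero_of_mul_eq_zero` and **`eventually_pos_family_oneRate` (THE CORE LEMMA)**: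
  `P` real symmetric (hermitian), `S₀`, `N` ARBITRARY real matrices, `B : ι × α` with `P B = 0`, `C = Bᵀ S₀ B` hermitian.  Then there is
  `Y > 0` such that for every `y ≥ Y` the family «positive eigenvectors of `P`» ⊔ «`B`-images of the positive eigenvectors of `C`» is a
  POSITIVE family for the one-rate pencil `y•P + S₀ − y⁻¹•N` (the form is `> 0` at every non-trivial combination).  MECHANISM: multiply
  the `P`-coefficients by `s = y^{-1/2}`; in the rescaled coefficients the form is `cᵀ𝕄(s)c` for the POLYNOMIAL matrix family
  `𝕄(s) = diag(λ⁺(P)) ⊕ 0 + Gram(ṽ(s), S₀ − s²N)`, `ṽ(s) = (s·u_i) ⊔ (B e_j)`, whose value at `s = 0` is `diag(λ⁺(P)) ⊕ diag(λ⁺(C))`,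
  positive definite (`P B = 0` decouples the two blocks); persistence of positive families (`Inertia.eventually_pos_family`, applied on
  coefficient space with the standard family) gives `ε`, and `Y = (2/ε)²`.
* §2 `card_le_posIndex_add_card_of_ker_subset_range` — `P ⪰ 0` and `ker P ⊆ range B` ⇒ `card ι ≤ π(P) + card α` (the zero eigenvectors
  of `P` pull back to an independent family in `ℝ^α`).

[folklore] (spectral theorem; persistence of definite families).  Axioms `propext`, `Classical.choice`, `Quot.sound`.  No definitions.
-/

-- layout Summits/ValiantsHypothesis/ValiantsHypothesis forces the duplicated namespace component
set_option linter.dupNamespace false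

namespace Summit.ValiantsHypothesis.ValiantsHypothesis.Theorems.LacunarySymmetroidMatrixDescartes

open Polynomial Matrix Finset
open scoped BigOperators Topology

namespace GramDual

/-! ## §0 Gram forms of a scale-dependent vector family -/

section GramForm

variable {ι γ : Type} [Fintype ι]

/-- The GRAM FORM of a vector family `v` under a matrix `G`: `cᵀ [v_k ⬝ G v_{k'}] c = (Σ c_k v_k) ⬝ G (Σ c_k v_k)`. [folklore] -/
theorem gramForm_eq [Fintype γ] (G : Matrix ι ι ℝ) (v : γ → ι → ℝ) (c : γ → ℝ) :
    c ⬝ᵥ ((Matrix.of fun k k' : γ => v k ⬝ᵥ (G *ᵥ v k')) *ᵥ c)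
      = (∑ k, c k • v k) ⬝ᵥ (G *ᵥ ∑ k, c k • v k) := by
  have hR : (∑ k, c k • v k) ⬝ᵥ (G *ᵥ ∑ k, c k • v k) = ∑ k, c k * ∑ k', (v k ⬝ᵥ (G *ᵥ v k')) * c k' := by
    rw [sum_dotProduct]
    refine Finset.sum_congr rfl fun k _ => ?_
    rw [smul_dotProduct, smul_eq_mul, Matrix.mulVec_sum, dotProduct_sum]
    congr 1
    refine Finset.sum_congr rfl fun k' _ => ?_
    rw [Matrix.mulVec_smul, dotProduct_smul, smul_eq_mul, mul_comm]
  have hL : ∀ k, ((Matrix.of fun k k' : γ => v k ⬝ᵥ (G *ᵥ v k')) *ᵥ c) k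
      = ∑ k', (v k ⬝ᵥ (G *ᵥ v k')) * c k' := fun k => rfl
  rw [hR]
  show (∑ k, c k * ((Matrix.of fun k k' : γ => v k ⬝ᵥ (G *ᵥ v k')) *ᵥ c) k) = _
  exact Finset.sum_congr rfl fun k _ => by rw [hL]

/-- Entrywise continuity of the Gram matrix of a continuous scale-dependent family under a continuous matrix family.
[folklore] -/
theorem continuous_gramEntry (G : ℝ → Matrix ι ι ℝ) (hG : ∀ a b, Continuous fun s => G s a b) (v : γ → ℝ → ι → ℝ)
    (hv : ∀ k a, Continuous fun s => v k s a) (k k' : γ) :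
    Continuous fun s => v k s ⬝ᵥ (G s *ᵥ v k' s) := by
  unfold dotProduct Matrix.mulVec
  refine continuous_finsetSum _ fun a _ => (hv k a).mul ?_
  exact continuous_finsetSum _ fun b _ => (hG a b).mul (hv k' b)

end GramForm

/-! ## §1 The core: an asymptotic positive family for the one-rate comparison pencil `y•P + S₀ − y⁻¹•N` -/

section Core

variable {ι : Type} [Fintype ι] [DecidableEq ι]

omit [DecidableEq ι] in
/-- For a PSD `P` with `P B = 0`: `P (B y) = 0`. [folklore] -/
theorem mulVec_mulVec_eq_zero_of_mul_eq_zero {α : Type} [Fintype α] {P : Matrix ι ι ℝ} {B : Matrix ι α ℝ}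
    (hPB : P * B = 0) (y : α → ℝ) : P *ᵥ (B *ᵥ y) = 0 := by
  rw [Matrix.mulVec_mulVec, hPB, Matrix.zero_mulVec]

/-- **THE CORE LEMMA.**  `P` symmetric (hermitian), `S₀`, `N` arbitrary, `B` with `P B = 0`, `C = Bᵀ S₀ B` hermitian.  The family made
of the positive eigenvectors of `P` and the `B`-images of the positive eigenvectors of `C` is a POSITIVE family for the one-rate pencil
`y•P + S₀ − y⁻¹•N` for all large `y`.  (Rescale the `P`-coefficients by `s = y^{-1/2}`: the Gram form becomes a polynomial family in `s` whose value at `s = 0`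
is `diag(λ⁺(P)) ⊕ diag(λ⁺(C))`, positive definite; persistence `Inertia.eventually_pos_family`.) [folklore] -/
theorem eventually_pos_family_oneRate (P S₀ N : Matrix ι ι ℝ) (hPh : P.IsHermitian) {α : Type} [Fintype α] [DecidableEq α] (B : Matrix ι α ℝ) (hPB : P * B = 0)
    (hC : (Bᵀ * S₀ * B).IsHermitian) :
    ∃ Y : ℝ, 0 < Y ∧ ∀ y : ℝ, Y ≤ y →
      ∀ c : ({i // 0 < hPh.eigenvalues i} ⊕ {j // 0 < hC.eigenvalues j}) → ℝ, c ≠ 0 →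
        0 < (∑ k, c k • Sum.elim (fun i : {i // 0 < hPh.eigenvalues i} => (hPh.eigenvectorBasis i.1).ofLp)
              (fun j : {j // 0 < hC.eigenvalues j} => B *ᵥ (hC.eigenvectorBasis j.1).ofLp) k) ⬝ᵥ
            ((y • P + S₀ - y⁻¹ • N) *ᵥ
              ∑ k, c k • Sum.elim (fun i : {i // 0 < hPh.eigenvalues i} => (hPh.eigenvectorBasis i.1).ofLp)
                (fun j : {j // 0 < hC.eigenvalues j} => B *ᵥ (hC.eigenvectorBasis j.1).ofLp) k) := by
  classical
  -- names
  set γ₁ := {i // 0 < hPh.eigenvalues i}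
  set γ₂ := {j // 0 < hC.eigenvalues j}
  set u : γ₁ → ι → ℝ := fun i => (hPh.eigenvectorBasis i.1).ofLp with hu
  set w : γ₂ → ι → ℝ := fun j => B *ᵥ (hC.eigenvectorBasis j.1).ofLp with hw
  -- the scale-dependent family `ṽ(s)`: `P`-part multiplied by `s`
  set vt : (γ₁ ⊕ γ₂) → ℝ → ι → ℝ := fun k s => Sum.elim (fun i => s • u i) (fun j => w j) k with hvt
  -- the matrix family `G(s) = S₀ − s²•N` and the Gram family `𝕄(s) = diag(λ⁺(P)) ⊕ 0 + Gram(ṽ(s), G(s))`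
  set G : ℝ → Matrix ι ι ℝ := fun s => S₀ - (s * s) • N with hGdef
  set M : ℝ → Matrix (γ₁ ⊕ γ₂) (γ₁ ⊕ γ₂) ℝ := fun s =>
    Matrix.of (fun k k' : γ₁ ⊕ γ₂ =>
      (match k, k' with
        | Sum.inl i, Sum.inl i' => if i = i' then hPh.eigenvalues i.1 else 0
        | _, _ => 0)
      + vt k s ⬝ᵥ (G s *ᵥ vt k' s)) with hMdef
  -- continuity of `M`
  have hGc : ∀ a b, Continuous fun s => G s a b := by
    intro a b
    simp only [hGdef, Matrix.sub_apply, Matrix.smul_apply, smul_eq_mul]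
    fun_prop
  have hvtc : ∀ k a, Continuous fun s => vt k s a := by
    intro k a
    cases k with
    | inl i => simp only [hvt, Sum.elim_inl, Pi.smul_apply, smul_eq_mul]; fun_prop
    | inr j => simp only [hvt, Sum.elim_inr]; exact continuous_const
  have hMc : ∀ k k', Continuous fun s => M s k k' := by
    intro k k'
    simp only [hMdef, Matrix.of_apply]
    exact continuous_const.add (continuous_gramEntry G hGc vt hvtc k k')
  -- the Gram form of `M(s)` on the standard family `e_k`: `cᵀ M(s) c = Σ λ_i a_i² + ṽ_s(c)ᵀ G(s) ṽ_s(c)`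
  have hform : ∀ (s : ℝ) (c : γ₁ ⊕ γ₂ → ℝ),
      (∑ k, c k • (Pi.single k (1:ℝ) : γ₁ ⊕ γ₂ → ℝ)) ⬝ᵥ (M s *ᵥ ∑ k, c k • (Pi.single k (1:ℝ) : γ₁ ⊕ γ₂ → ℝ))
        = (∑ i : γ₁, hPh.eigenvalues i.1 * c (Sum.inl i) ^ 2)
          + (∑ k, c k • vt k s) ⬝ᵥ (G s *ᵥ ∑ k, c k • vt k s) := by
    intro s c
    have hc : ∑ k, c k • (Pi.single k (1:ℝ) : γ₁ ⊕ γ₂ → ℝ) = c := by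
      funext k'
      rw [Finset.sum_apply]
      have h1 : ∀ k : γ₁ ⊕ γ₂, (c k • (Pi.single k (1:ℝ) : γ₁ ⊕ γ₂ → ℝ)) k' = if k' = k then c k else 0 := by
        intro k
        rw [Pi.smul_apply, Pi.single_apply, smul_eq_mul, mul_ite, mul_one, mul_zero]
      simp only [h1]
      rw [Finset.sum_ite_eq]
      simp
    rw [hc]
    have hsplit : M s = Matrix.of (fun k k' : γ₁ ⊕ γ₂ =>
        (match k, k' with
          | Sum.inl i, Sum.inl i' => if i = i' then hPh.eigenvalues i.1 else 0
          | _, _ => (0:ℝ))) + Matrix.of (fun k k' : γ₁ ⊕ γ₂ => vt k s ⬝ᵥ (G s *ᵥ vt k' s)) := by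
      ext k k'; simp only [hMdef, Matrix.of_apply, Matrix.add_apply]
    rw [hsplit, Matrix.add_mulVec, dotProduct_add, gramForm_eq]
    congr 1
    -- the diagonal part
    simp only [dotProduct, Matrix.mulVec, Matrix.of_apply, Fintype.sum_sum_type]
    have h1 : ∀ i : γ₁, (∑ i' : γ₁, (if i = i' then hPh.eigenvalues i.1 else 0) * c (Sum.inl i'))
        = hPh.eigenvalues i.1 * c (Sum.inl i) := by
      intro i
      rw [Finset.sum_eq_single i (fun i' _ hi' => by rw [if_neg (Ne.symm hi'), zero_mul]) (by simp)]
      rw [if_pos rfl]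
    simp only [h1, zero_mul, Finset.sum_const_zero, add_zero, mul_zero]
    refine Finset.sum_congr rfl fun i _ => ?_
    ring
  -- positivity at `s = 0`: the form is `Σ λ_i a_i² + Σ μ_j b_j²`
  have hPsymm : P.IsSymm := Inertia.isSymm_of_isHermitian hPh
  have hv0 : ∀ c : γ₁ ⊕ γ₂ → ℝ, ∑ k, c k • vt k 0
      = B *ᵥ ∑ j : γ₂, c (Sum.inr j) • (hC.eigenvectorBasis j.1).ofLp := by
    intro c
    rw [Fintype.sum_sum_type]
    have h1 : ∑ i : γ₁, c (Sum.inl i) • vt (Sum.inl i) 0 = 0 :=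
      Finset.sum_eq_zero fun i _ => by simp only [hvt, Sum.elim_inl, zero_smul, smul_zero]
    rw [h1, zero_add]
    simp only [hvt, Sum.elim_inr, hw]
    exact sum_smul_mulVec B _ _
  have h0 : ∀ c : γ₁ ⊕ γ₂ → ℝ, c ≠ 0 →
      0 < (∑ k, c k • (Pi.single k (1:ℝ) : γ₁ ⊕ γ₂ → ℝ)) ⬝ᵥ
        (M 0 *ᵥ ∑ k, c k • (Pi.single k (1:ℝ) : γ₁ ⊕ γ₂ → ℝ)) := by
    intro c hc0
    rw [hform, hv0]
    have hG0 : G 0 = S₀ := by simp only [hGdef, mul_zero, zero_smul, sub_zero]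
    rw [hG0, form_mulVec_eq, Inertia.form_subtype_eigen hC (fun j => 0 < hC.eigenvalues j)]
    -- both sums are non-negative; one of them has a positive term
    have hnn1 : ∀ i : γ₁, 0 ≤ hPh.eigenvalues i.1 * c (Sum.inl i) ^ 2 := fun i => mul_nonneg i.2.le (sq_nonneg _)
    have hnn2 : ∀ j : γ₂, 0 ≤ hC.eigenvalues j.1 * c (Sum.inr j) ^ 2 := fun j => mul_nonneg j.2.le (sq_nonneg _)
    obtain ⟨k, hk⟩ : ∃ k, c k ≠ 0 := by
      by_contra h; push Not at h; exact hc0 (funext h)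
    cases k with
    | inl i =>
      have hi : 0 < hPh.eigenvalues i.1 * c (Sum.inl i) ^ 2 := mul_pos i.2 (by positivity)
      have h1 : 0 < ∑ i : γ₁, hPh.eigenvalues i.1 * c (Sum.inl i) ^ 2 :=
        lt_of_lt_of_le hi (Finset.single_le_sum (fun i _ => hnn1 i) (Finset.mem_univ i))
      linarith [Finset.sum_nonneg fun j (_ : j ∈ (Finset.univ : Finset γ₂)) => hnn2 j]
    | inr j =>
      have hj : 0 < hC.eigenvalues j.1 * c (Sum.inr j) ^ 2 := mul_pos j.2 (by positivity)
      have h1 : 0 < ∑ j : γ₂, hC.eigenvalues j.1 * c (Sum.inr j) ^ 2 :=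
        lt_of_lt_of_le hj (Finset.single_le_sum (fun j _ => hnn2 j) (Finset.mem_univ j))
      linarith [Finset.sum_nonneg fun i (_ : i ∈ (Finset.univ : Finset γ₁)) => hnn1 i]
  -- persistence near `s = 0`
  have hev := Inertia.eventually_pos_family M hMc (fun k => (Pi.single k (1:ℝ) : γ₁ ⊕ γ₂ → ℝ)) 0 h0
  obtain ⟨ε, hε, hball⟩ := Metric.eventually_nhds_iff.1 hev
  refine ⟨(2 / ε) ^ 2, by positivity, fun y hy c' hc' => ?_⟩
  have hY : 0 < (2 / ε) ^ 2 := by positivity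
  have hypos : 0 < y := lt_of_lt_of_le hY hy
  set s : ℝ := (Real.sqrt y)⁻¹ with hsdef
  have hsqrt : 0 < Real.sqrt y := Real.sqrt_pos.2 hypos
  have hs : 0 < s := by rw [hsdef]; exact inv_pos.2 hsqrt
  have hsε : s < ε := by
    have h1 : 2 / ε ≤ Real.sqrt y := by
      rw [← Real.sqrt_sq (by positivity : (0:ℝ) ≤ 2 / ε)]
      exact Real.sqrt_le_sqrt hy
    have h2 : s ≤ (2 / ε)⁻¹ := by
      rw [hsdef]; exact inv_anti₀ (by positivity) h1
    rw [inv_div] at h2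
    linarith
  have hss : s * s = y⁻¹ := by
    rw [hsdef, ← mul_inv, Real.mul_self_sqrt hypos.le]
  have hys : y * (s * s) = 1 := by rw [hss, mul_inv_cancel₀ hypos.ne']
  -- the rescaled coefficients
  set c : γ₁ ⊕ γ₂ → ℝ := Sum.elim (fun i => s⁻¹ * c' (Sum.inl i)) (fun j => c' (Sum.inr j)) with hcdef
  have hc0 : c ≠ 0 := by
    intro h
    apply hc'
    funext k
    cases k with
    | inl i =>
      have := congrFun h (Sum.inl i)
      simp only [hcdef, Sum.elim_inl, Pi.zero_apply, mul_eq_zero, inv_eq_zero, hs.ne', false_or] at this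
      exact this
    | inr j =>
      have := congrFun h (Sum.inr j)
      simpa only [hcdef, Sum.elim_inr, Pi.zero_apply] using this
  have hkey : (∑ k, c' k • Sum.elim (fun i : γ₁ => (hPh.eigenvectorBasis i.1).ofLp)
        (fun j : γ₂ => B *ᵥ (hC.eigenvectorBasis j.1).ofLp) k) = ∑ k, c k • vt k s := by
    rw [Fintype.sum_sum_type, Fintype.sum_sum_type]
    congr 1
    · refine Finset.sum_congr rfl fun i _ => ?_
      simp only [Sum.elim_inl, hcdef, hvt, hu, smul_smul]
      congr 1
      field_simp
  have hpos := hball (y := s) (by rw [dist_zero_right, Real.norm_eq_abs, abs_of_pos hs]; exact hsε) c hc0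
  rw [hform] at hpos
  rw [hkey]
  -- expand the one-rate form at the rescaled combination
  set V := ∑ k, c k • vt k s with hVdef
  set a : γ₁ → ℝ := fun i => c (Sum.inl i) with hadef
  have hVsplit : V = s • (∑ i : γ₁, a i • u i) + B *ᵥ ∑ j : γ₂, c (Sum.inr j) • (hC.eigenvectorBasis j.1).ofLp := by
    rw [hVdef, Fintype.sum_sum_type]
    congr 1
    · rw [Finset.smul_sum]
      refine Finset.sum_congr rfl fun i _ => ?_
      simp only [hvt, Sum.elim_inl, hadef, smul_smul, mul_comm]
    · simp only [hvt, Sum.elim_inr, hw]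
      exact sum_smul_mulVec B _ _
  have hPV : P *ᵥ V = s • (P *ᵥ ∑ i : γ₁, a i • u i) := by
    rw [hVsplit, Matrix.mulVec_add, Matrix.mulVec_smul, mulVec_mulVec_eq_zero_of_mul_eq_zero hPB, add_zero]
  have hUPU : (∑ i : γ₁, a i • u i) ⬝ᵥ (P *ᵥ ∑ i : γ₁, a i • u i) = ∑ i : γ₁, hPh.eigenvalues i.1 * a i ^ 2 := by
    simp only [hu]
    exact Inertia.form_subtype_eigen hPh (fun i => 0 < hPh.eigenvalues i) a
  have hVPV : V ⬝ᵥ (P *ᵥ V) = (s * s) * ∑ i : γ₁, hPh.eigenvalues i.1 * a i ^ 2 := by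
    rw [hPV, dotProduct_smul, smul_eq_mul, dotProduct_mulVec_comm_of_isSymm hPsymm V, hPV, dotProduct_smul,
      smul_eq_mul, hUPU, mul_assoc]
  have hGs : V ⬝ᵥ (G s *ᵥ V) = V ⬝ᵥ (S₀ *ᵥ V) - (s * s) * (V ⬝ᵥ (N *ᵥ V)) := by
    simp only [hGdef, Matrix.sub_mulVec, Matrix.smul_mulVec, dotProduct_sub, dotProduct_smul, smul_eq_mul]
  have hexp : V ⬝ᵥ ((y • P + S₀ - y⁻¹ • N) *ᵥ V)
      = y * (V ⬝ᵥ (P *ᵥ V)) + V ⬝ᵥ (S₀ *ᵥ V) - y⁻¹ * (V ⬝ᵥ (N *ᵥ V)) := by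
    simp only [Matrix.sub_mulVec, Matrix.add_mulVec, Matrix.smul_mulVec, dotProduct_sub, dotProduct_add,
      dotProduct_smul, smul_eq_mul]
  rw [hexp, hVPV, ← hss, ← mul_assoc, hys, one_mul]
  rw [hGs] at hpos
  have hsum : (∑ i : γ₁, hPh.eigenvalues i.1 * c (Sum.inl i) ^ 2) = ∑ i : γ₁, hPh.eigenvalues i.1 * a i ^ 2 :=
    Finset.sum_congr rfl fun i _ => by rw [hadef]
  linarith

end Core

/-! ## §2 The spanning count: `card ι ≤ π(P) + dim W` when `ker P ⊆ range B` -/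

section SpanCount

variable {ι : Type} [Fintype ι] [DecidableEq ι]

/-- If `P ⪰ 0` and every kernel vector of `P` is in the range of `B : ι × α`, then `card ι ≤ π(P) + card α`. [folklore] -/
theorem card_le_posIndex_add_card_of_ker_subset_range {P : Matrix ι ι ℝ} (hP : P.PosSemidef) (hPh : P.IsHermitian)
    {α : Type} [Fintype α] (B : Matrix ι α ℝ) (hspan : ∀ v : ι → ℝ, P *ᵥ v = 0 → ∃ c : α → ℝ, B *ᵥ c = v) :
    Fintype.card ι ≤ Fintype.card {i // 0 < hPh.eigenvalues i} + Fintype.card α := by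
  classical
  -- the non-positive eigenvectors of `P` are kernel vectors
  have hker : ∀ i : {i // hPh.eigenvalues i ≤ 0}, P *ᵥ (hPh.eigenvectorBasis i.1).ofLp = 0 := by
    intro i
    have h0 : hPh.eigenvalues i.1 = 0 := le_antisymm i.2 (hP.eigenvalues_nonneg i.1)
    rw [hPh.mulVec_eigenvectorBasis i.1, h0, zero_smul]
  choose c hc using fun i : {i // hPh.eigenvalues i ≤ 0} => hspan _ (hker i)
  have hli : LinearIndependent ℝ c := by
    have h := Inertia.linearIndependent_subtype_eigen hPh (fun i => hPh.eigenvalues i ≤ 0)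
    have hcomp : (Matrix.mulVecLin B) ∘ c = fun i : {i // hPh.eigenvalues i ≤ 0} => (hPh.eigenvectorBasis i.1).ofLp := by
      funext i; simp only [Function.comp_apply, Matrix.mulVecLin_apply, hc i]
    rw [← hcomp] at h
    exact LinearIndependent.of_comp _ h
  have hcard := hli.fintype_card_le_finrank
  rw [Module.finrank_fintype_fun_eq_card] at hcard
  have hnonpos := Inertia.card_nonpos_eigs hPh
  have hle : Fintype.card {i // 0 < hPh.eigenvalues i} ≤ Fintype.card ι := Fintype.card_subtype_le _
  omega

end SpanCount

end GramDual

end Summit.ValiantsHypothesis.ValiantsHypothesis.Theorems.LacunarySymmetroidMatrixDescartes
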